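import Mathlib
import HarnessLib.Audit
import Summits.PneNP.PneNP.Theorems.PstarChordReadLemma
import Summits.PneNP.PneNP.Theorems.PstarFreshEraseTerminal
import Summits.PneNP.PneNP.Theorems.PstarFreshEraseGates

/-!
# A slice-generic chord read through ONE fresh single-use gate kills a terminal core (ROUND-24, O1 at exact tightness; memo §6.4)

FRONTIER range-avoidance ladder, rung F-N3, ROUND 24 (cell `pnp-ideate`, prover-2 memo `g19/O1-CHORD-READ.md` §6.4 "THE RESIDUAL, SHARPENED";
typed target `PstarCoreBoundTargets.TerminalPeelable` (p646951); restricted-model proof complexity — nothing here bears on `P` versus `NP`).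

Composition of prover-1's `PstarFreshEraseTerminal.terminal_eraseGate` (erasing a fresh single-use gate `(p, z)` on an AND variable of a clean output
keeps the core terminal, NO Assumption A) with the chord-read lemma `PstarChordReadLemma.false_of_monomial_free_chord`:

* `false_of_freshGate_chord` — a terminal core has no chord `c` whose AND pair is touched by exactly one monomial, that monomial a `FreshGate` of
  `w₁`, if `c` is slice-generic for the gate-erased menu;  `false_of_freshGate_chord₂` — the same with the gate in `w₂`.

Hence (memo §6.4) in any terminal configuration on a tight structure every slice-generic chord carries either at least two monomials on its AND pair or
a gate whose partner is SHARED (in another monomial, a linear part, or an output of `J₀`).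
-/

set_option linter.dupNamespace false -- `Summit.PneNP.PneNP.…`: summit = sub-problem name (D-0017 single-conjunct layout)

open Finset Literature.Computability.Complexity
open Summit.PneNP.PneNP.Theorems.PstarTyped (Typed)
open Summit.PneNP.PneNP.Theorems.PstarSALevel (varSet bdry BoundaryExpanding SimpleOverlap)
open Summit.PneNP.PneNP.Theorems.PstarChordRepair (IsChord)
open Summit.PneNP.PneNP.Theorems.PstarCoreBoundTargets (Terminal)
open Summit.PneNP.PneNP.Theorems.PstarFreshErase (FreshGate eraseGate)
open Summit.PneNP.PneNP.Theorems.PstarFreshEraseTerminal (terminal_eraseGate)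
open Summit.PneNP.PneNP.Theorems.PstarFreshEraseGates (terminal_symm)
open Summit.PneNP.PneNP.Theorems.PstarChordReadLemma (SliceGeneric false_of_monomial_free_chord)

namespace Summit.PneNP.PneNP.Theorems.PstarChordReadFresh

variable {n m : ℕ}

/-- **A slice-generic chord read through exactly one fresh single-use gate of `w₁` kills the terminal core.**  `g = (p, z)` is a `FreshGate` of
`w₁` on a private `p` of the chord `c`, no other monomial of `w₁, w₂` touches the AND pair of `c`, and `c` is slice-generic for the menu with `g`
erased: contradiction (`terminal_eraseGate`, then `false_of_monomial_free_chord`). -/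
theorem false_of_freshGate_chord {r : ℕ} (I : LocalMap 4 n m) (hI : I.IsPure xorAndPred) (hT : Typed I) (hS : SimpleOverlap I)
    (hB : BoundaryExpanding r I) {y : Fin m → Bool} {J₀ : Finset (Fin m)} {w₁ w₂ : Finset (Fin n) × Finset (Fin m) × Bool}
    (ht : Terminal I r y J₀ w₁ w₂) {g c : Fin m} {p z : Fin n} (hF : FreshGate I J₀ w₁ w₂ g p z) (hc : c ∈ J₀)
    (hpc : I.vars c 2 = p ∨ I.vars c 3 = p) (hch : IsChord I J₀ c)
    (halone : ∀ g' ∈ w₁.2.1 ∪ w₂.2.1, g' ≠ g → ∀ s : Fin 4, 2 ≤ s.val → I.vars g' s ≠ I.vars c 2 ∧ I.vars g' s ≠ I.vars c 3)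
    (hgen : SliceGeneric I y J₀ c (w₁.2.1.erase g ∪ w₂.2.1)) : False := by
  have hne : I.vars c 2 ≠ I.vars c 3 := fun h => absurd (hI.2 c h) (by decide)
  have ht' : Terminal I r y J₀ (eraseGate w₁ g) w₂ := terminal_eraseGate I hI hT hS hB hF hc hpc hne hch halone ht
  refine false_of_monomial_free_chord I hI hT hS hB ht' hc hch (fun g' hg' => ?_) hgen
  have hg' : g' ∈ w₁.2.1.erase g ∪ w₂.2.1 := hg'
  have hne' : g' ≠ g := by
    rcases mem_union.1 hg' with h | h
    · exact ne_of_mem_erase h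
    · exact fun e => hF.2.1 (e ▸ h)
  have hmem : g' ∈ w₁.2.1 ∪ w₂.2.1 := by
    rcases mem_union.1 hg' with h | h
    · exact mem_union_left _ (mem_of_mem_erase h)
    · exact mem_union_right _ h
  have h2 := halone g' hmem hne' 2 (by decide)
  have h3 := halone g' hmem hne' 3 (by decide)
  exact ⟨⟨h2.1, h3.1⟩, h2.2, h3.2⟩

/-- **The same with the gate in `w₂`.** -/
theorem false_of_freshGate_chord₂ {r : ℕ} (I : LocalMap 4 n m) (hI : I.IsPure xorAndPred) (hT : Typed I) (hS : SimpleOverlap I)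
    (hB : BoundaryExpanding r I) {y : Fin m → Bool} {J₀ : Finset (Fin m)} {w₁ w₂ : Finset (Fin n) × Finset (Fin m) × Bool}
    (ht : Terminal I r y J₀ w₁ w₂) {g c : Fin m} {p z : Fin n} (hF : FreshGate I J₀ w₂ w₁ g p z) (hc : c ∈ J₀)
    (hpc : I.vars c 2 = p ∨ I.vars c 3 = p) (hch : IsChord I J₀ c)
    (halone : ∀ g' ∈ w₁.2.1 ∪ w₂.2.1, g' ≠ g → ∀ s : Fin 4, 2 ≤ s.val → I.vars g' s ≠ I.vars c 2 ∧ I.vars g' s ≠ I.vars c 3)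
    (hgen : SliceGeneric I y J₀ c (w₂.2.1.erase g ∪ w₁.2.1)) : False :=
  false_of_freshGate_chord I hI hT hS hB (terminal_symm ht) hF hc hpc hch (fun g' hg' => halone g' (by rwa [union_comm])) hgen

end Summit.PneNP.PneNP.Theorems.PstarChordReadFresh
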